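import Mathlib.Data.ZMod.Basic
import Literature.Computability.AlgebraicComplexity.STPPWreathTPP
import Literature.Computability.AlgebraicComplexity.SDPPCyclicPowerConstruction
import Literature.Computability.AlgebraicComplexity.StrongUSP
import HarnessLib

/-!
# CKSU 2005, Prop. 3.3 (arXiv Prop. 15): a strong USP gives the TPP in `Sym(U) ⋉ (Cyc_m^k)^U`

Topic `Literature/Computability/AlgebraicComplexity`. Source: H. Cohn, R. Kleinberg, B. Szegedy,
C. Umans, *Group-theoretic algorithms for matrix multiplication*, FOCS 2005, §3.2 "Using USPs"
(arXiv:math/0511460, held text `paper:arxiv-math_0511460`, chunk p0006 L50–125; FOCS Prop. 3.3 /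
Cor. 3.4 = arXiv Prop. 15 / Cor. 16), read this session:

"Let `H` be the abelian group of all functions from `U × [k]` to the cyclic group `Cyc_m` … The
symmetric group `Sym(U)` acts on `H` via `π(h)(u,i) = h(π⁻¹(u),i)` … Let `G` be the semidirect product
`H ⋊ Sym(U)`, and define subsets `S₁`, `S₂`, and `S₃` of `G` by letting `Sᵢ` consist of all products
`hπ` with `π ∈ Sym(U)` and `h ∈ H` satisfying `h(u,j) ≠ 0` iff `u_j = i` for all `u ∈ U` and
`j ∈ [k]`. **Proposition 3.3.** If `U` is a strong USP, then `S₁`, `S₂`, and `S₃` satisfy the triple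
product property. *Proof.* … we must have `π₁π₁'⁻¹π₂π₂'⁻¹π₃π₃'⁻¹ = 1`. Set `π = π₁π₁'⁻¹` and
`ρ = π₁π₁'⁻¹π₂π₂'⁻¹`. Then the remaining condition … is that … `h₁ − h₃' + π(h₂ − h₁') + ρ(h₃ − h₂') = 0`.
Note that `(h₁−h₃')(u,j) ≠ 0` iff `u_j ∈ {1,3}`, `π(h₂−h₁')(u,j) ≠ 0` iff `(π⁻¹(u))_j ∈ {2,1}`, and
`ρ(h₃−h₂')(u,j) ≠ 0` iff `(ρ⁻¹(u))_j ∈ {3,2}`. By the definition of a strong USP, either `π = ρ = 1` or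
else there exist `u` and `j` such that exactly one of these three conditions holds, in which case [the
equation] cannot hold. Thus, `π = ρ = 1` … Then we have `h₁+h₂+h₃ = h₁'+h₂'+h₃'`, which implies
`hᵢ' = hᵢ` for each `i` (because for different choices of `i` they have disjoint supports)."
"Analyzing this construction using Corollary 1.9 and the bound `[G : H] = |U|!` on the largest
character degree of `G`, we get: **Corollary 3.4.** …
`ω ≤ 3 log m / log(m−1) − 3 log(|U|!) / (|U| k log(m−1))`."

## Formalisation

The group is the tree's `SymWreath (Fin k → C) s` (`STPPWreathTPP.lean`: `Sym_s ⋉ (C^k)^s` for the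
`s` rows of the puzzle `row : Fin s → Fin k → Fin 3`, symbols `{1,2,3}` coded `{0,1,2}`), for any
finite abelian `C` in place of `Cyc_m` (`m := |C|`); `Sᵢ = uspWreathSet C row i` is
`stppSet (u ↦ A_{F(u,i)})` with `A_F = supportSet C F` the vectors supported exactly on
`F(u,i) = {j : u_j = i}` (`SDPPCyclicPowerConstruction.lean`).

* `CohnKleinbergSzegedyUmans2005_prop15` — **Prop. 3.3 / 15, proof as printed**: `IsStrongUSP row`
  (the tree's strong USPs, `StrongUSP.lean`) ⇒ `S₁, S₂, S₃` satisfy the TPP (`Q(S)`-form), i.e.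
  `realizesTPP_of_isStrongUSP`: `G` realizes `⟨|S₁|, |S₂|, |S₃|⟩`.
* `card_uspWreathSet`, `prod_card_uspWreathSet`: `|Sᵢ| = s! ∏_u (m−1)^{#{j : u_j = i}}`,
  `|S₁||S₂||S₃| = (s!)³ (m−1)^{sk}`.
* `CohnKleinbergSzegedyUmans2005_cor16_ineq` — the group-theoretic inequality behind Cor. 3.4 / 16,
  "using Corollary 1.9 and the bound `[G : H] = |U|!`" (the tree's PROVED `CKSU2005_cor19_holds` and
  `SymWreath.maxCharDegree_symWreath_le`): `s! · ((m−1)^{sk})^{ω/3} ≤ m^{sk}`. Solving for `ω` gives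
  exactly Cor. 16 as displayed, which the tree already has as
  `Summit.MatrixMultiplication.OmegaCensus.omega_le_of_isStrongUSP` (proved there by the LOCAL route,
  Prop. 6.3 + Thm. 6.1 + Thm. 5.5); this file is the printed GROUP route. 0 named facts.
-/

noncomputable section

namespace Literature.Computability.AlgebraicComplexity

open Finset Literature.RepresentationTheory.FiniteGroups SDPPCyclicPower SymWreath

namespace StrongUSPWreath

variable (C : Type) [AddCommGroup C] [Fintype C] [DecidableEq C] {s k : ℕ}

/-- The coordinate set `{j : u_j = i}` of row `u` for the symbol `i`. [cite: CohnKleinbergSzegedyUmans2005, Prop. 3.3 (arXiv Prop. 15)] -/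
def symbolSet (row : Fin s → Fin k → Fin 3) (u : Fin s) (i : Fin 3) : Finset (Fin k) :=
  Finset.univ.filter fun j => row u j = i

/-- **`Sᵢ = {hπ : π ∈ Sym(U), h(u,j) ≠ 0 iff u_j = i}`** in `G = Sym(U) ⋉ (C^k)^U`.
[cite: CohnKleinbergSzegedyUmans2005, Prop. 3.3 (arXiv Prop. 15)] -/
def uspWreathSet (row : Fin s → Fin k → Fin 3) (i : Fin 3) : Finset (SymWreath (Fin k → C) s) :=
  stppSet fun u => supportSet C (symbolSet row u i)

variable {C}

/-- Membership in `Sᵢ`: `h(u,j) ≠ 0 ↔ u_j = i`. [cite: CohnKleinbergSzegedyUmans2005, Prop. 3.3 (arXiv Prop. 15)] -/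
theorem mem_uspWreathSet {row : Fin s → Fin k → Fin 3} {i : Fin 3} {w : SymWreath (Fin k → C) s} :
    w ∈ uspWreathSet C row i ↔ ∀ u j, (row u j = i → w.left u j ≠ 0) ∧ (row u j ≠ i → w.left u j = 0) := by
  simp only [uspWreathSet, mem_stppSet, mem_supportSet, symbolSet, Finset.mem_filter, Finset.mem_univ,
    true_and]

/-- `|Sᵢ| = (∏_u (m−1)^{#{j : u_j = i}}) · s!`. [cite: CohnKleinbergSzegedyUmans2005, Cor. 3.4 (arXiv Cor. 16), derivation] -/
theorem card_uspWreathSet (row : Fin s → Fin k → Fin 3) (i : Fin 3) :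
    (uspWreathSet C row i).card =
      (∏ u, (Fintype.card C - 1) ^ (symbolSet row u i).card) * s.factorial := by
  rw [uspWreathSet, card_stppSet]
  simp only [card_supportSet]

omit [AddCommGroup C] [Fintype C] [DecidableEq C] in
/-- The three symbol sets of a row partition its `k` coordinates. [folklore] -/
private theorem sum_card_symbolSet (row : Fin s → Fin k → Fin 3) (u : Fin s) :
    (symbolSet row u 0).card + (symbolSet row u 1).card + (symbolSet row u 2).card = k := by
  have h := Finset.card_eq_sum_card_fiberwise (f := row u) (s := (Finset.univ : Finset (Fin k)))
    (t := (Finset.univ : Finset (Fin 3))) (fun _ _ => Finset.mem_univ _)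
  rw [Finset.card_univ, Fintype.card_fin, Fin.sum_univ_three] at h
  simp only [symbolSet]
  omega

/-- `|S₁||S₂||S₃| = (s!)³ (m−1)^{sk}`. [cite: CohnKleinbergSzegedyUmans2005, Cor. 3.4 (arXiv Cor. 16), derivation] -/
theorem prod_card_uspWreathSet (row : Fin s → Fin k → Fin 3) :
    (uspWreathSet C row 0).card * (uspWreathSet C row 1).card * (uspWreathSet C row 2).card =
      s.factorial ^ 3 * (Fintype.card C - 1) ^ (s * k) := by
  rw [card_uspWreathSet, card_uspWreathSet, card_uspWreathSet]
  have key : (∏ u, (Fintype.card C - 1) ^ (symbolSet row u 0).card) *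
      (∏ u, (Fintype.card C - 1) ^ (symbolSet row u 1).card) *
      (∏ u, (Fintype.card C - 1) ^ (symbolSet row u 2).card) = (Fintype.card C - 1) ^ (s * k) := by
    rw [← Finset.prod_mul_distrib, ← Finset.prod_mul_distrib]
    simp_rw [← pow_add, sum_card_symbolSet]
    rw [Finset.prod_const, Finset.card_univ, Fintype.card_fin, ← pow_mul, mul_comm k s]
  rw [← key]; ring

/-! ### Proposition 3.3 / 15 -/

/-- `(s s'⁻¹)ᵢ = sᵢ − s'_{P⁻¹ i}` with `P = π_s π_{s'}⁻¹`. [folklore] -/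
private theorem mul_inv_left_apply' {H : Type*} [AddCommGroup H] {n : ℕ} (a a' : SymWreath H n)
    (j : Fin n) : (a * a'⁻¹).left j = a.left j - a'.left ((a * a'⁻¹).right⁻¹ j) := by
  simp [sub_eq_add_neg, mul_inv_rev]

/-- `(XYZ)ᵢ = Xᵢ + Y_{P⁻¹ i} + Z_{Q⁻¹ P⁻¹ i}`. [folklore] -/
private theorem mul_mul_left_apply' {H : Type*} [AddCommGroup H] {n : ℕ} (X Y Z : SymWreath H n)
    (i : Fin n) :
    (X * Y * Z).left i = X.left i + Y.left (X.right⁻¹ i) + Z.left (Y.right⁻¹ (X.right⁻¹ i)) := by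
  simp [mul_inv_rev]

omit [Fintype C] [DecidableEq C] in
/-- In an additive group, a sum of three terms of which exactly one is non-zero is non-zero.
[folklore] -/
private theorem sum3_ne_zero {x y z : C} :
    ((x ≠ 0 ∧ y = 0 ∧ z = 0) ∨ (x = 0 ∧ y ≠ 0 ∧ z = 0) ∨ (x = 0 ∧ y = 0 ∧ z ≠ 0)) →
      x + y + z ≠ 0 := by
  rintro (⟨hx, hy, hz⟩ | ⟨hx, hy, hz⟩ | ⟨hx, hy, hz⟩) <;> simp [hx, hy, hz]

/-- **Cohn–Kleinberg–Szegedy–Umans 2005, Proposition 3.3 (arXiv Prop. 15): "If `U` is a strong USP,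
then `S₁`, `S₂`, and `S₃` satisfy the triple product property"** in `G = Sym(U) ⋉ (Cyc_m^k)^U` —
here for any finite abelian `C` in place of `Cyc_m`, in the `Q(S)`-form of the tree's `RealizesTPP`.
Proof as printed: the `Sym(U)`-part gives `PQR = 1`; the `H`-part, regrouped as
`(h₁ − h₃') + π(h₂ − h₁') + ρ(h₃ − h₂') = 0` (`π = P`, `ρ = PQ`), has at row `u`, coordinate `j`
three summands that vanish iff `u_j = 2`, `(P⁻¹u)_j = 3`, `((PQ)⁻¹u)_j = 1` respectively; the strong
USP property for `((PQ)⁻¹, 1, P⁻¹)` yields `(u, j)` where exactly two vanish unless `P = Q = 1`;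
then `hᵢ = hᵢ'` by disjoint supports. [cite: CohnKleinbergSzegedyUmans2005, Prop. 3.3 (arXiv Prop. 15)] -/
theorem CohnKleinbergSzegedyUmans2005_prop15 {row : Fin s → Fin k → Fin 3} (hU : IsStrongUSP row) :
    ∀ a ∈ uspWreathSet C row 0, ∀ a' ∈ uspWreathSet C row 0, ∀ b ∈ uspWreathSet C row 1,
      ∀ b' ∈ uspWreathSet C row 1, ∀ c ∈ uspWreathSet C row 2, ∀ c' ∈ uspWreathSet C row 2,
      a * a'⁻¹ * (b * b'⁻¹) * (c * c'⁻¹) = 1 → a = a' ∧ b = b' ∧ c = c' := by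
  intro a ha a' ha' b hb b' hb' c hc c' hc' h
  rw [mem_uspWreathSet] at ha ha' hb hb' hc hc'
  have hPQR : (a * a'⁻¹).right * (b * b'⁻¹).right * (c * c'⁻¹).right = 1 :=
    congrArg SymWreath.right h
  set P := (a * a'⁻¹).right with hP
  set Q := (b * b'⁻¹).right with hQ
  set R := (c * c'⁻¹).right with hR
  have hRQP : ∀ i, R⁻¹ (Q⁻¹ (P⁻¹ i)) = i := fun i => by
    have e : (P * Q * R)⁻¹ = 1 := by rw [hPQR, inv_one]
    have := congrArg (fun g : Equiv.Perm (Fin s) => g i) e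
    simpa [mul_inv_rev] using this
  -- coordinate `(u, j)` of the `H`-part
  have hL : ∀ u j, (a.left u j - c'.left u j) + (b.left (P⁻¹ u) j - a'.left (P⁻¹ u) j) +
      (c.left (Q⁻¹ (P⁻¹ u)) j - b'.left (Q⁻¹ (P⁻¹ u)) j) = 0 := by
    intro u j
    have hL0 : (a * a'⁻¹ * (b * b'⁻¹) * (c * c'⁻¹)).left u = 0 := by rw [h]; rfl
    rw [mul_mul_left_apply', mul_inv_left_apply' a a', mul_inv_left_apply' b b',
      mul_inv_left_apply' c c'] at hL0
    rw [← hP, ← hQ, ← hR, hRQP u] at hL0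
    have hj := congrFun hL0 j
    simp only [Pi.add_apply, Pi.sub_apply, Pi.zero_apply] at hj
    rw [← hj]; abel
  -- `P = 1` and `Q = 1` by the strong USP property for `((PQ)⁻¹, 1, P⁻¹)`
  have hPQ : P = 1 ∧ Q = 1 := by
    rcases hU (P * Q)⁻¹ 1 P⁻¹ with ⟨h1, h2⟩ | ⟨u, j, hx⟩
    · have hP1 : P = 1 := inv_eq_one.mp h2.symm
      refine ⟨hP1, ?_⟩
      rw [hP1, one_mul] at h1
      exact inv_eq_one.mp h1
    · exfalso
      have huj := hL u j
      rw [mul_inv_rev] at hx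
      simp only [Equiv.Perm.mul_apply, Equiv.Perm.one_apply] at hx
      -- the three vanishing conditions
      have v1 : a.left u j - c'.left u j = 0 ↔ row u j = 1 := by
        constructor
        · intro h0
          by_contra hne
          rcases (by omega : (row u j).val = 0 ∨ (row u j).val = 2 ∨ (row u j).val = 1) with e | e | e
          · have e' : row u j = 0 := Fin.ext e
            exact (ha u j).1 e' (by rw [(hc' u j).2 (by rw [e']; decide), sub_zero] at h0; exact h0)
          · have e' : row u j = 2 := Fin.ext e
            have := (hc' u j).1 e'
            rw [(ha u j).2 (by rw [e']; decide), zero_sub, neg_eq_zero] at h0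
            exact this h0
          · exact hne (Fin.ext e)
        · intro e
          rw [(ha u j).2 (by rw [e]; decide), (hc' u j).2 (by rw [e]; decide), sub_zero]
      have v2 : b.left (P⁻¹ u) j - a'.left (P⁻¹ u) j = 0 ↔ row (P⁻¹ u) j = 2 := by
        constructor
        · intro h0
          by_contra hne
          rcases (by omega : (row (P⁻¹ u) j).val = 1 ∨ (row (P⁻¹ u) j).val = 0 ∨
              (row (P⁻¹ u) j).val = 2) with e | e | e
          · have e' : row (P⁻¹ u) j = 1 := Fin.ext e
            exact (hb _ j).1 e' (by rw [(ha' _ j).2 (by rw [e']; decide), sub_zero] at h0; exact h0)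
          · have e' : row (P⁻¹ u) j = 0 := Fin.ext e
            have := (ha' _ j).1 e'
            rw [(hb _ j).2 (by rw [e']; decide), zero_sub, neg_eq_zero] at h0
            exact this h0
          · exact hne (Fin.ext e)
        · intro e
          rw [(hb _ j).2 (by rw [e]; decide), (ha' _ j).2 (by rw [e]; decide), sub_zero]
      have v3 : c.left (Q⁻¹ (P⁻¹ u)) j - b'.left (Q⁻¹ (P⁻¹ u)) j = 0 ↔ row (Q⁻¹ (P⁻¹ u)) j = 0 := by
        constructor
        · intro h0
          by_contra hne
          rcases (by omega : (row (Q⁻¹ (P⁻¹ u)) j).val = 2 ∨ (row (Q⁻¹ (P⁻¹ u)) j).val = 1 ∨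
              (row (Q⁻¹ (P⁻¹ u)) j).val = 0) with e | e | e
          · have e' : row (Q⁻¹ (P⁻¹ u)) j = 2 := Fin.ext e
            exact (hc _ j).1 e' (by rw [(hb' _ j).2 (by rw [e']; decide), sub_zero] at h0; exact h0)
          · have e' : row (Q⁻¹ (P⁻¹ u)) j = 1 := Fin.ext e
            have := (hb' _ j).1 e'
            rw [(hc _ j).2 (by rw [e']; decide), zero_sub, neg_eq_zero] at h0
            exact this h0
          · exact hne (Fin.ext e)
        · intro e
          rw [(hc _ j).2 (by rw [e]; decide), (hb' _ j).2 (by rw [e]; decide), sub_zero]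
      -- exactly two of the three vanish
      refine sum3_ne_zero (C := C) ?_ huj
      rcases hx with ⟨e0, e1, e2⟩ | ⟨e0, e1, e2⟩ | ⟨e0, e1, e2⟩
      · exact Or.inr (Or.inl ⟨v1.mpr e1, fun h0 => e2 (v2.mp h0), v3.mpr e0⟩)
      · exact Or.inl ⟨fun h0 => e1 (v1.mp h0), v2.mpr e2, v3.mpr e0⟩
      · exact Or.inr (Or.inr ⟨v1.mpr e1, v2.mpr e2, fun h0 => e0 (v3.mp h0)⟩)
  obtain ⟨hP1, hQ1⟩ := hPQ
  have hR1 : R = 1 := by rwa [hP1, hQ1, one_mul, one_mul] at hPQR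
  -- `h₁ + h₂ + h₃ = h₁' + h₂' + h₃'` coordinatewise, and disjoint supports
  have hcoord : ∀ u j, a.left u j = a'.left u j ∧ b.left u j = b'.left u j ∧ c.left u j = c'.left u j := by
    intro u j
    have huj := hL u j
    simp only [hP1, hQ1, inv_one, Equiv.Perm.one_apply] at huj
    rcases (by omega : (row u j).val = 0 ∨ (row u j).val = 1 ∨ (row u j).val = 2) with e | e | e
    · have e' : row u j = 0 := Fin.ext e
      have hb0 := (hb u j).2 (by rw [e']; decide); have hb'0 := (hb' u j).2 (by rw [e']; decide)
      have hc0 := (hc u j).2 (by rw [e']; decide); have hc'0 := (hc' u j).2 (by rw [e']; decide)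
      rw [hb0, hb'0, hc0, hc'0] at huj
      refine ⟨?_, by rw [hb0, hb'0], by rw [hc0, hc'0]⟩
      have : a.left u j - a'.left u j = 0 := by rw [← huj]; abel
      exact sub_eq_zero.mp this
    · have e' : row u j = 1 := Fin.ext e
      have ha0 := (ha u j).2 (by rw [e']; decide); have ha'0 := (ha' u j).2 (by rw [e']; decide)
      have hc0 := (hc u j).2 (by rw [e']; decide); have hc'0 := (hc' u j).2 (by rw [e']; decide)
      rw [ha0, ha'0, hc0, hc'0] at huj
      refine ⟨by rw [ha0, ha'0], ?_, by rw [hc0, hc'0]⟩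
      have : b.left u j - b'.left u j = 0 := by rw [← huj]; abel
      exact sub_eq_zero.mp this
    · have e' : row u j = 2 := Fin.ext e
      have ha0 := (ha u j).2 (by rw [e']; decide); have ha'0 := (ha' u j).2 (by rw [e']; decide)
      have hb0 := (hb u j).2 (by rw [e']; decide); have hb'0 := (hb' u j).2 (by rw [e']; decide)
      rw [ha0, ha'0, hb0, hb'0] at huj
      refine ⟨by rw [ha0, ha'0], by rw [hb0, hb'0], ?_⟩
      have : c.left u j - c'.left u j = 0 := by rw [← huj]; abel
      exact sub_eq_zero.mp this
  have e1 : a.right * a'.right⁻¹ = 1 := by rw [hP] at hP1; exact hP1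
  have e2 : b.right * b'.right⁻¹ = 1 := by rw [hQ] at hQ1; exact hQ1
  have e3 : c.right * c'.right⁻¹ = 1 := by rw [hR] at hR1; exact hR1
  exact ⟨SymWreath.ext (funext fun u => funext fun j => (hcoord u j).1) (mul_inv_eq_one.mp e1),
    SymWreath.ext (funext fun u => funext fun j => (hcoord u j).2.1) (mul_inv_eq_one.mp e2),
    SymWreath.ext (funext fun u => funext fun j => (hcoord u j).2.2) (mul_inv_eq_one.mp e3)⟩

/-- **`Sym(U) ⋉ (C^k)^U` realizes `⟨|S₁|, |S₂|, |S₃|⟩` for a strong USP `U`** (Prop. 3.3 / 15 in the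
tree's `RealizesTPP`). [cite: CohnKleinbergSzegedyUmans2005, Prop. 3.3 (arXiv Prop. 15)] -/
theorem realizesTPP_of_isStrongUSP {row : Fin s → Fin k → Fin 3} (hU : IsStrongUSP row) :
    RealizesTPP (SymWreath (Fin k → C) s) (uspWreathSet C row 0).card (uspWreathSet C row 1).card
      (uspWreathSet C row 2).card :=
  ⟨uspWreathSet C row 0, uspWreathSet C row 1, uspWreathSet C row 2, rfl, rfl, rfl,
    CohnKleinbergSzegedyUmans2005_prop15 hU⟩

/-- **The group-theoretic inequality behind Cor. 3.4 / 16** ("Analyzing this construction using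
Corollary 1.9 and the bound `[G : H] = |U|!` on the largest character degree of `G`"): for a strong
USP of `s` rows and width `k` and any `m = |C|`, `s! · ((m−1)^{sk})^{ω/3} ≤ m^{sk}` — i.e.
`((s!)³(m−1)^{sk})^{ω/3} ≤ (s!)^{ω−2} · s! m^{sk}`, from the tree's proved `CKSU2005_cor19_holds` and
`SymWreath.maxCharDegree_symWreath_le`. Solved for `ω` this is Cor. 16 as displayed
(`ω ≤ 3 log m/log(m−1) − 3 log(s!)/(sk log(m−1))`, the tree's `omega_le_of_isStrongUSP`).
[cite: CohnKleinbergSzegedyUmans2005, Cor. 3.4 (arXiv Cor. 16)] -/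
theorem CohnKleinbergSzegedyUmans2005_cor16_ineq {row : Fin s → Fin k → Fin 3} (hU : IsStrongUSP row) :
    (s.factorial : ℝ) * (((Fintype.card C - 1 : ℕ) : ℝ) ^ (s * k)) ^ (omega ℂ / 3) ≤
      (Fintype.card C : ℝ) ^ (s * k) := by
  have h := CKSU2005_cor19_holds.rpow_le_of_maxCharDegree_le (realizesTPP_of_isStrongUSP (C := C) hU)
    (maxCharDegree_symWreath_le (H := Fin k → C) (n := s))
  rw [card_symWreath, prod_card_uspWreathSet, Fintype.card_fun, Fintype.card_fin, ← pow_mul,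
    mul_comm k s] at h
  have hF : (0 : ℝ) < (s.factorial : ℝ) := by exact_mod_cast Nat.factorial_pos s
  have hP : (0 : ℝ) ≤ (((Fintype.card C - 1) ^ (s * k) : ℕ) : ℝ) := Nat.cast_nonneg _
  push_cast at h hP ⊢
  generalize (s.factorial : ℝ) = F at h hF ⊢
  generalize ((Fintype.card C - 1 : ℕ) : ℝ) ^ (s * k) = X at h hP ⊢
  generalize ((Fintype.card C : ℕ) : ℝ) ^ (s * k) = M at h ⊢
  have hω : (3 : ℝ) * (omega ℂ / 3) = (omega ℂ - 2) + 2 := by ring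
  have hlhs : (F ^ 3 * X) ^ (omega ℂ / 3) = F ^ (omega ℂ - 2) * (F ^ 2 * X ^ (omega ℂ / 3)) := by
    rw [Real.mul_rpow (pow_nonneg hF.le 3) hP, ← Real.rpow_natCast F 3, ← Real.rpow_mul hF.le,
      Nat.cast_ofNat, hω, Real.rpow_add hF, Real.rpow_two, mul_assoc]
  rw [hlhs, mul_comm M F] at h
  have h2 : F ^ 2 * X ^ (omega ℂ / 3) ≤ F * M := le_of_mul_le_mul_left h (Real.rpow_pos_of_pos hF _)
  rw [pow_two, mul_assoc] at h2
  exact le_of_mul_le_mul_left h2 hF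

/-- **Cohn–Kleinberg–Szegedy–Umans 2005, Corollary 3.4 (arXiv Cor. 16), by the printed GROUP route**
("Analyzing this construction using Corollary 1.9 and the bound `[G : H] = |U|!` on the largest
character degree of `G`, we get: If `U` is a strong USP of width `k`, and `m ≥ 3` …
`ω ≤ 3 log m/log(m−1) − 3 log(|U|!)/(|U| k log(m−1))`"): from `CohnKleinbergSzegedyUmans2005_cor16_ineq`
with `C = Cyc_m = ZMod m`, taking logarithms. The same inequality is the census's
`Summit.MatrixMultiplication.OmegaCensus.omega_le_of_isStrongUSP`, proved there by the local route
(Prop. 6.3 + Thm. 6.1 + Thm. 5.5). [cite: CohnKleinbergSzegedyUmans2005, Cor. 3.4 (arXiv Cor. 16)] -/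
theorem CohnKleinbergSzegedyUmans2005_cor16 {row : Fin s → Fin k → Fin 3} (hU : IsStrongUSP row)
    (hs : 0 < s) (hk : 0 < k) {m : ℕ} (hm : 3 ≤ m) :
    omega ℂ ≤ 3 * Real.log m / Real.log ((m : ℝ) - 1) -
      3 * Real.log (s.factorial : ℕ) / (((s * k : ℕ) : ℝ) * Real.log ((m : ℝ) - 1)) := by
  haveI : NeZero m := ⟨by omega⟩
  have h := CohnKleinbergSzegedyUmans2005_cor16_ineq (C := ZMod m) hU
  rw [ZMod.card] at h
  have hm1 : ((m - 1 : ℕ) : ℝ) = (m : ℝ) - 1 := by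
    rw [Nat.cast_sub (by omega), Nat.cast_one]
  rw [hm1] at h
  have h3 : (3 : ℝ) ≤ (m : ℝ) := by exact_mod_cast hm
  have hlog1 : 0 < Real.log ((m : ℝ) - 1) := Real.log_pos (by linarith)
  have hsk : (0 : ℝ) < ((s * k : ℕ) : ℝ) := by exact_mod_cast Nat.mul_pos hs hk
  have hF : (0 : ℝ) < ((s.factorial : ℕ) : ℝ) := by exact_mod_cast Nat.factorial_pos s
  have hX : (0 : ℝ) < ((m : ℝ) - 1) ^ (s * k) := pow_pos (by linarith) _
  have hlog := Real.log_le_log (mul_pos hF (Real.rpow_pos_of_pos hX _)) h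
  rw [Real.log_mul hF.ne' (Real.rpow_pos_of_pos hX _).ne', Real.log_rpow hX, Real.log_pow,
    Real.log_pow] at hlog
  -- `hlog : log s! + (ω/3) (sk log(m−1)) ≤ sk log m`
  have key : omega ℂ * (((s * k : ℕ) : ℝ) * Real.log ((m : ℝ) - 1)) ≤
      3 * (((s * k : ℕ) : ℝ) * Real.log m) - 3 * Real.log ((s.factorial : ℕ) : ℝ) := by
    linarith
  have e : 3 * Real.log m / Real.log ((m : ℝ) - 1) -
      3 * Real.log (s.factorial : ℕ) / (((s * k : ℕ) : ℝ) * Real.log ((m : ℝ) - 1)) =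
      (3 * (((s * k : ℕ) : ℝ) * Real.log m) - 3 * Real.log ((s.factorial : ℕ) : ℝ)) /
        (((s * k : ℕ) : ℝ) * Real.log ((m : ℝ) - 1)) := by
    rw [eq_div_iff (mul_pos hsk hlog1).ne', sub_mul, div_mul_eq_mul_div, div_mul_eq_mul_div,
      mul_div_assoc, mul_div_assoc]
    field_simp
  rw [e, le_div_iff₀ (mul_pos hsk hlog1)]
  exact key

end StrongUSPWreath

end Literature.Computability.AlgebraicComplexity

end
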